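import Summits.MatrixMultiplication.OmegaCensus.SmallFormats.MatMul22nRankGF5XCapParity
import Summits.MatrixMultiplication.OmegaCensus.SmallFormats.MatMul22nRankGF5ThreeNPlusFour
import HarnessLib

/-!
# ω-census family (a): reduction of `R_𝔽₅(⟨2,2,n⟩) ≥ 3n + 5` (`n ≥ 36`) to the slack-4 X-cap statement `NoTightPoint5 4 112`

Cell `pub-omega` (unit `pub-omega-tensor-g11`), topic `Summits/MatrixMultiplication/OmegaCensus` (sub-folder `SmallFormats`).
Framing (verbatim): lottery ticket; floor = certified bounds/negative ranges. HONEST FRAMING: a CONDITIONAL reduction, not a bound: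
`NoTightPoint5 4 112` ("the 350 cap / row-plane rows of `xcapSys5s 4` have no integer point in `[0,4]^157` of total `≥ 112`", i.e. the
census datum `M₅(4) ≤ 111`, engine-grade ×2 by tensor g9 (even/odd enumeration) and tensor g11 (exact LP branch-and-bound), NOT yet
kernel) implies `3n + 5 ≤ R_𝔽₅(⟨2,2,n⟩)` for every `n ≥ 36`. Unlike `card_lt_of_cert_slack` the abstraction `rows350_of_comp` keeps
only the 350 symmetric rows (no WLOG rows, no sandwich normalisation), so that `NoTightPoint5 s T` can be attacked with the symmetry
transport (`MatMul22nRankGF5XCapSymmetry`), the rectangle-parity lemma (`MatMul22nRankGF5XCapParity`) and pattern certificates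
(`BoxCertificatePattern`) — the successor blueprint of `pub-omega-tensor-g11/METHOD-PARITY-g11.md`. Nothing here is progress on `ω`.
-/

namespace Summit.MatrixMultiplication.OmegaCensus.SmallFormats

open Module Matrix Finset Literature.Computability.AlgebraicComplexity
open Summit.MatrixMultiplication.OmegaCensus.RankOnePlaneCapGeneral

/-- The slack-`s` X-cap statement at target `T` ("`M₅(s) < T`"): no nonnegative integer point of the 350 cap / row-plane rows of
`xcapSys5s s` inside the box `[0, s]` has total `≥ T`. The census datum `M₅(4) ≤ 111` is `NoTightPoint5 4 112`. -/
def NoTightPoint5 (s T : ℕ) : Prop :=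
  ∀ x : ℕ → ℕ, (∀ j, x j ≤ s) → (∀ r < 350, rowVal5 s x r ≤ rhs5s s r) → ∑ j ∈ range 157, (x j : ℤ) < T

variable {ι : Type*} [Fintype ι] [DecidableEq ι]

/-- **Abstraction of a computation (slack-generic, symmetric rows only).** The X-form class counts of a computation of `⟨2,2,n⟩`
over `𝔽₅` with `|ι| ≤ 3n + s` products lie in `[0, s]`, satisfy the 350 cap / row-plane rows of `xcapSys5s s`, and total `|ι|`. -/
theorem rows350_of_comp {s n : ℕ} (hι : Fintype.card ι ≤ 3 * n + s)
    (β : BilinComp (mulBilin (ZMod 5) 2 2 n) ι) (u : ι → Fin 2 × Fin 2 → ZMod 5) (hA : ∀ i x, β.f i x = dotX (u i) x) :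
    (∀ j, xcount5 u j ≤ s) ∧ (∀ r < 350, rowVal5 s (xcount5 u) r ≤ rhs5s s r) ∧
      ∑ j ∈ range 157, (xcount5 u j : ℤ) = Fintype.card ι := by
  classical
  set x : ℕ → ℕ := fun j => xcount5 u j with hx
  have hcap : ∀ ρ < 344, (univ.filter fun t => rowMem5 ρ (xvar5 (u t)) = true).card ≤ s := by
    intro ρ hρ; have := card_rowMem5_cap_le β u hA hρ; omega
  have hbox : ∀ j, x j ≤ s := by
    intro j
    by_cases hj : j < 157
    · obtain ⟨ρ, hρ, hmem⟩ : ∃ ρ < 344, rowMem5 ρ j = true := by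
        by_cases hj' : j < 156
        · exact ⟨_, (first5_ok' hj').1, (first5_ok' hj').2⟩
        · have : j = 156 := by omega
          subst this
          exact ⟨0, by norm_num, rowMem5_z' (by norm_num)⟩
      refine le_trans ?_ (hcap ρ hρ)
      refine Finset.card_le_card fun t ht => ?_
      simp only [mem_filter, mem_univ, true_and] at ht ⊢
      rw [ht]; exact hmem
    · have : x j = 0 := by
        simp only [hx, xcount5, Finset.card_eq_zero, Finset.filter_eq_empty_iff]
        intro t _ ht
        have := xvar5_lt (u t); omega
      omega
  refine ⟨hbox, ?_, ?_⟩
  · intro ρ hρ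
    unfold rowVal5
    have eA : ∀ j ∈ range 157, (xcapSys5s s).A ρ j * (xcount5 u j : ℤ)
        = (if rowMem5 ρ j then (1 : ℤ) else 0) * (xcount5 u j : ℤ) := by
      intro j hj
      rw [xcapSys5s_A, xcapSys5_A_eq' (by omega) (mem_range.1 hj), rowCoef5_eq_mem' hρ (mem_range.1 hj)]
    rw [sum_congr rfl eA, sum_rowMem5_xcount5]
    by_cases h344 : ρ < 344
    · have h1 := hcap ρ h344
      have : rhs5s s ρ = s := by simp [rhs5s, h344]
      rw [this]; exact_mod_cast h1
    · obtain ⟨i, hi⟩ : ∃ i : Fin 6, ρ = 344 + i.val := ⟨⟨ρ - 344, by omega⟩, by simp; omega⟩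
      have h1 := card_rowMem5_row_le β u hA i
      have : rhs5s s ρ = 2 * (s : ℤ) := by simp [rhs5s, h344, hρ]
      rw [this, hi]
      have h2 : (univ.filter fun t => rowMem5 (344 + i.val) (xvar5 (u t)) = true).card ≤ 2 * s := by omega
      exact_mod_cast h2
  · have := sum_xcount5 u
    exact_mod_cast this

/-- **Slack-generic reduction.** If the slack-`s` system has no point of total `≥ T`, then every `n` with `T ≤ 3n + s` whose floor
`3n + s ≤ R_𝔽₅(⟨2,2,n⟩)` is already known gets the next floor `3n + s + 1`. -/
theorem floor_succ_of_noTightPoint5 {s T : ℕ} (H : NoTightPoint5 s T) (n : ℕ) (hn : T ≤ 3 * n + s)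
    (hprev : 3 * n + s ≤ tensorRank (matMulTensor (ZMod 5) 2 2 n)) :
    3 * n + s + 1 ≤ tensorRank (matMulTensor (ZMod 5) 2 2 n) := by
  classical
  by_contra hlt
  obtain ⟨w, u, v, hdec⟩ := exists_triad_decomposition_tensorRank (matMulTensor (ZMod 5) 2 2 n)
  have hA : ∀ i x, (bilinCompOfTriads (ZMod 5) w u v hdec).f i x = dotX (u i) x := fun i x => rfl
  have hr : Fintype.card (Fin (tensorRank (matMulTensor (ZMod 5) 2 2 n))) ≤ 3 * n + s := by
    simp only [Fintype.card_fin]; omega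
  obtain ⟨hbox, hrows, htot⟩ := rows350_of_comp hr (bilinCompOfTriads (ZMod 5) w u v hdec) u hA
  have h := H (xcount5 u) hbox hrows
  rw [htot] at h
  simp only [Fintype.card_fin] at h
  omega

/-- **Reduction for the census cell.** `NoTightPoint5 4 112` (`M₅(4) ≤ 111`) implies `3n + 5 ≤ R_𝔽₅(⟨2,2,n⟩)` for every `n ≥ 36`
(one more than the tree's `3n + 4`, `MatMul22nRankGF5ThreeNPlusFour`; the cell `n = 36`, `R ≥ 113`, is beyond print). -/
theorem three_mul_add_five_le_of_noTightPoint5 (H : NoTightPoint5 4 112) (n : ℕ) (hn : 36 ≤ n) :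
    3 * n + 5 ≤ tensorRank (matMulTensor (ZMod 5) 2 2 n) :=
  floor_succ_of_noTightPoint5 H n (by omega) (three_mul_add_four_le_tensorRank_matMulTensor_22n_gf5 n (by omega))

/-- The same reduction for all three orientations `⟨2,2,n⟩`, `⟨2,n,2⟩`, `⟨n,2,2⟩`. -/
theorem three_mul_add_five_le_orientations_of_noTightPoint5 (H : NoTightPoint5 4 112) (n : ℕ) (hn : 36 ≤ n) :
    3 * n + 5 ≤ tensorRank (matMulTensor (ZMod 5) 2 2 n) ∧ 3 * n + 5 ≤ tensorRank (matMulTensor (ZMod 5) 2 n 2) ∧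
      3 * n + 5 ≤ tensorRank (matMulTensor (ZMod 5) n 2 2) := by
  refine ⟨three_mul_add_five_le_of_noTightPoint5 H n hn, ?_, ?_⟩
  · rw [(Blaser2013_lemma55 (ZMod 5) 2 n 2).1]; exact three_mul_add_five_le_of_noTightPoint5 H n hn
  · rw [(Blaser2013_lemma55 (ZMod 5) n 2 2).2.1]; exact three_mul_add_five_le_of_noTightPoint5 H n hn

end Summit.MatrixMultiplication.OmegaCensus.SmallFormats
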